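import Summits.HodgeConjecture.HodgeConjecture.Theses.CurveNetMordellWeil
import Summits.HodgeConjecture.HodgeConjecture.Theorems.NikulinTwinTransportLefschetzOneOneK3GAGA
import Literature.AlgebraicGeometry.HodgeTheory.LefschetzOneOneOfGlobalSections

/-!
# Route CurveNetMordellWeil — support item `LefschetzOneOne` (stmt-HodgeConjecture-8544): closing one-liners

Helper file (`--supports stmt-HodgeConjecture-8544`). The route item
`Summit.HodgeConjecture.HodgeConjecture.Theses.CurveNetMordellWeil.LefschetzOneOne` (the `q = 1`
base of the induction on codimension in the deciding theorem `closes`) is, VERBATIM, the tree's named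
fact `Literature.AlgebraicGeometry.HodgeTheory.lefschetzOneOne_rational` (Lefschetz's theorem on
`(1,1)`-classes, rational form: Voisin I, Thm. 11.30 + Cor. 11.34, §11.3.2) — `complexBetti X k` being an
`abbrev` of `singularCohomology ℂ ℂ (ComplexPoints X) k` (`lefschetzOneOne_iff_lefschetzOneOne_rational`,
`Iff.rfl`). This file records the item's closure MODULO each of the inputs to which the tree has
reduced that fact, so that the item closes by a one-liner the moment any of them is discharged:

* `lefschetzOneOne_of_lefschetzOneOne_rational` — from the named fact itself;
* `lefschetzOneOne_of_serreGAGA` — from GAGA for line bundles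
  (`serreGAGA_lineCocycle_iso_cartierDivisorCocycle`, Serre 1956 n° 20 Prop. 18; via
  `lefschetzOneOne_rational_of_serreGAGA` of `Theorems/NikulinTwinTransportLefschetzOneOneK3GAGA`:
  Čech integrality, the Chern–Weil heart, rigidity, Chow, universal coefficients and
  `c₁(𝒪_X(D)^an) ∈ N¹H²` are all proved in the tree);
* `lefschetzOneOne_of_span_chernCharacter_le` — from the degree-`2` slice of Voisin I, Thm. 11.32 `⊆`
  (the `p = 1` instance of the named fact `span_holomorphicBundleChernCharacter_le_algebraicClasses` of
  `Literature/AlgebraicGeometry/HodgeTheory/HolomorphicBundleChernCharacterSplit`, spelled out);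
* `lefschetzOneOne_of_isTrivialOn` — from the meromorphic-section lemma of the proof of Voisin I,
  Cor. 11.34 (every cocycle line bundle on a Hodge model of a smooth projective variety is
  holomorphically trivial off a proper analytic subset);
* `lefschetzOneOne_of_globalSections` — from the Kodaira–Serre existence of sections alone
  (`σ₁ ∈ Γ(L ⊗ L')`, `σ₂ ∈ Γ(L')` non-zero; Voisin I, Thm. 7.11 in the proof of Cor. 11.34);
* `lefschetzOneOne_of_hodgeConjecture` — upper bound: the item is the degree-`2` fragment of the summit
  statement (nothing stronger than `HodgeConjecture` is claimed).

All theorems here are CONDITIONAL (their hypotheses are the undischarged classical inputs); the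
mathematics of each reduction lives in the cited Literature / Theorems files.
-/

noncomputable section

-- Single-problem summit: the namespace `Summit.HodgeConjecture.HodgeConjecture.…` repeats the summit name
-- by design (D-0017); the lakefile turns `linter.dupNamespace` off for the `Summits` library, repeated
-- here so that stand-alone elaboration of this file is warning-free too.
set_option linter.dupNamespace false

namespace Summit.HodgeConjecture.HodgeConjecture.Theorems

open scoped Manifold
open Literature.Geometry.Kaehler
open Literature.AlgebraicGeometry
open Literature.AlgebraicGeometry.HodgeTheory
open Summit.HodgeConjecture.HodgeConjecture.Theses

/-- **The route item `LefschetzOneOne` is definitionally the named fact `lefschetzOneOne_rational`**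
(`complexBetti X (2 * 1)` unfolds to `singularCohomology ℂ ℂ (ComplexPoints X) (2 * 1)`).
[cite: VoisinHodgeI2002, Thm. 11.30 and §11.3.2] -/
theorem lefschetzOneOne_iff_lefschetzOneOne_rational :
    CurveNetMordellWeil.LefschetzOneOne ↔ lefschetzOneOne_rational :=
  Iff.rfl

/-- **The item from the named fact** (the intended closure: once `lefschetzOneOne_rational` is
discharged in `Literature/`, this one-liner closes stmt-HodgeConjecture-8544).
[cite: VoisinHodgeI2002, Thm. 11.30, Cor. 11.34 and §11.3.2] -/
theorem lefschetzOneOne_of_lefschetzOneOne_rational (h : lefschetzOneOne_rational) :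
    CurveNetMordellWeil.LefschetzOneOne :=
  fun _ _ hX c hc h11 ↦ h hX c hc h11

/-- **The item from GAGA for line bundles alone** (Serre, GAGA n° 20 Prop. 18 with `Pic X = CaCl X`:
every holomorphic line cocycle on `X^an` is holomorphically isomorphic to `𝒪_X(D)^an` for a Cartier
divisor `D`; everything downstream is proved in the tree, `lefschetzOneOne_rational_of_serreGAGA`).
[cite: SerreGAGA1956, n° 20 Prop. 18] [cite: VoisinHodgeI2002, Thm. 11.30, Thm. 11.33 and §11.3.2] -/
theorem lefschetzOneOne_of_serreGAGA (hG : serreGAGA_lineCocycle_iso_cartierDivisorCocycle) :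
    CurveNetMordellWeil.LefschetzOneOne :=
  lefschetzOneOne_of_lefschetzOneOne_rational (lefschetzOneOne_rational_of_serreGAGA hG)

/-- **The item from Voisin I, Thm. 11.32 `⊆` in degree `2`** (the `ℂ`-span of the first Chern
characters of the holomorphic bundles on `X^an` consists of divisor classes — the `p = 1` slice of the
named fact `span_holomorphicBundleChernCharacter_le_algebraicClasses`), through the unconditional
analytic Lefschetz `(1,1)` theorem `exists_eq_smul_chernCharacter_lineBundle`.
[cite: VoisinHodgeI2002, Thm. 11.30 and Thm. 11.32] -/
theorem lefschetzOneOne_of_span_chernCharacter_le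
    (hle : ∀ ⦃n : ℕ⦄ ⦃X : Motives.SchemeOver ℂ⦄, Motives.IsSmoothProjective n X →
      ∀ A : HodgeModel n X, Submodule.span ℂ (A.holomorphicBundleChernCharacter 1) ≤ algebraicClasses X 1) :
    CurveNetMordellWeil.LefschetzOneOne :=
  lefschetzOneOne_of_lefschetzOneOne_rational (lefschetzOneOne_rational_of_span_chernCharacter_le hle)

/-- **The item from the meromorphic-section lemma of Voisin I, Cor. 11.34 alone**: every cocycle
holomorphic line bundle on a Hodge model of a smooth projective variety is holomorphically trivial off
a proper closed analytic subset (Čech integrality, the Weil–Kostant heart, rigidity, Chow's theorem and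
universal coefficients being theorems of the tree:
`Literature.AlgebraicGeometry.HodgeTheory.lefschetzOneOne_rational_of_isTrivialOn`).
[cite: VoisinHodgeI2002, Thm. 11.30 and Cor. 11.34 (proof)] -/
theorem lefschetzOneOne_of_isTrivialOn
    (h₂ : ∀ ⦃n : ℕ⦄ ⦃X : Motives.SchemeOver ℂ⦄, Motives.IsSmoothProjective n X →
      ∀ (A : HodgeModel n X) (ι : Type) (L : HolomorphicLineBundle ι A.model A.carrier),
      ∃ S : Set A.carrier, IsAnalyticSet 𝓘(ℂ, A.model) S ∧ S ≠ Set.univ ∧ L.IsTrivialOn Sᶜ) :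
    CurveNetMordellWeil.LefschetzOneOne :=
  lefschetzOneOne_of_lefschetzOneOne_rational
    (Literature.AlgebraicGeometry.HodgeTheory.lefschetzOneOne_rational_of_isTrivialOn h₂)

/-- **The item from the Kodaira–Serre existence of sections alone** (for every cocycle line bundle `L`
on a Hodge model of a smooth projective variety, some cocycle line bundle `L'` with non-zero global
sections `σ₁` of `L ⊗ L'` and `σ₂` of `L'` — printed with `L' = H^{⊗N}`, `H` ample, `N ≫ 0`,
Voisin I, Thm. 7.11; the meromorphic section `σ₁/σ₂` and everything downstream are proved:
`Literature.AlgebraicGeometry.HodgeTheory.lefschetzOneOne_rational_of_globalSections`).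
[cite: VoisinHodgeI2002, Cor. 11.34 (proof) and Thm. 7.11] -/
theorem lefschetzOneOne_of_globalSections
    (h : ∀ ⦃n : ℕ⦄ ⦃X : Motives.SchemeOver ℂ⦄, Motives.IsSmoothProjective n X →
      ∀ (A : HodgeModel n X) (ι : Type) (L : HolomorphicLineBundle ι A.model A.carrier),
      ∃ (κ : Type) (L' : HolomorphicLineBundle κ A.model A.carrier)
        (σ₁ : (L.tensor L').GlobalSection) (σ₂ : L'.GlobalSection),
        σ₁.zeroSet ≠ Set.univ ∧ σ₂.zeroSet ≠ Set.univ) :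
    CurveNetMordellWeil.LefschetzOneOne :=
  lefschetzOneOne_of_lefschetzOneOne_rational
    (Literature.AlgebraicGeometry.HodgeTheory.lefschetzOneOne_rational_of_globalSections h)

/-- **Upper bound: the item is the degree-`2` fragment of the summit statement** — the Hodge
conjecture for all smooth projective varieties implies `LefschetzOneOne` (so the item claims nothing
beyond the summit; `lefschetzOneOne_rational_of_hodgeConjectureFor`). [cite: VoisinHodgeI2002, §11.3.2] -/
theorem lefschetzOneOne_of_hodgeConjecture (h : _root_.HodgeConjecture) :
    CurveNetMordellWeil.LefschetzOneOne :=
  lefschetzOneOne_of_lefschetzOneOne_rational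
    (lefschetzOneOne_rational_of_hodgeConjectureFor fun _ _ hX ↦ h hX)

end Summit.HodgeConjecture.HodgeConjecture.Theorems

end
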